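import Summits.BirchSwinnertonDyer.BirchSwinnertonDyer.Theorems.PrintX8SmallImageMuBoundConjA
import Summits.BirchSwinnertonDyer.BirchSwinnertonDyer.Theorems.PrintX8SharpFlatMuDefect
import Summits.BirchSwinnertonDyer.Rank1Residual.Supersingular.X8PrintDischargeOnePrime
import Summits.BirchSwinnertonDyer.BirchSwinnertonDyer.Theses.PrintX8
import Summits.BirchSwinnertonDyer.BirchSwinnertonDyer.Theorems.PrintX8SmallImageTotallyRamified
import HarnessLib

/-!
# Route `PrintX8`, crux `MuBoundSmallImageX8` (stmt-BirchSwinnertonDyer-20622): the PER-PAIR CERTIFICATE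
# DOORS of the rider-free road (γ) beyond one class number — Fukuda's first-layer criteria (1994, Thm. 1)
# and Deo–Ray–Sujatha's (c2)-as-printed — and the NON-VACUOUS disjunctive class form asked for by the
# cell referee (R-60) (cell `bsd-print-x8`, D-0131 (2) print tier, prover seat p2 gen 3; `--supports` 20622)

PARTITION (cell bsd-print-x8, leaf `ClassX8`; 61 small-image census cells = the instances of 20622's
domain): closes NONE; 0 census cells move; BSD is not proved by any of this.  Beyond-print theorem: NO.

HONEST FRAMING.  Seat p2 g2 landed the road (γ) to the `μ`-child: per pair, Coates–Sujatha's statement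
(A) at `(W, 3)` ⟹ `μ(X^•) ≤ μ(Λ/(L^•))` for every colour (`PrintX8MuBoundConjA.X8.muBound_of_conjA`),
and (A) ⟸ ONE INTEGER `3 ∤ h(ℚ(W[3]))` (`PrintX8MuBoundConjAGlue.X8.conjA_of_not_surj_of_not_dvd_classNumber`:
Iwasawa 1956 + Coates–Sujatha 2005 Thm. 3.4, the «one prime above `3`» clause discharged on the class by
ty2 g3).  The kit census j283348 certifies that integer on 42 of the 61 cells; on the other 19 one has
`3 ∣ h(ℚ(W[3]))` (3-rank 2, 3 or 4).  THIS file adds, BY NAME and with printed hypotheses verbatim, the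
two further per-pair doors to (A) that the tree's Literature layer already carries, and answers the
referee's R-60 note:

* §1 (any `E/ℚ`, odd `p`) `conjA_of_totallyRamifiedFrom_of_classGroupPRank_one_eq` — **(A) at `(E, p)` ⟸
  Fukuda 1994 Thm. 1 (2)** (`IwasawaTheory.fukuda1994_thm1_classGroupPRank_const_of_succ_eq`, named fact):
  if the cyclotomic `ℤ_p`-extension of `L = ℚ(E[p])` is totally ramified at every ramified prime from
  the bottom (`TotallyRamifiedFrom κL 0`, Fukuda's index `n₀ = 0`) and `rank_p Cl(L₁) = rank_p Cl(L)`
  (`L₁` = first layer), then `μ(L_∞/L) = 0`, hence (A) by Coates–Sujatha Thm. 3.4; and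
  `conjA_of_totallyRamifiedFrom_of_classNumberPExp_one_eq` — the same from Thm. 1 (1)
  (`ord_p h(L₁) = ord_p h(L)`).  TWO-INTEGER certificates (`rank_3 Cl(L)`, `rank_3 Cl(L₁)`, `L₁` of degree
  48) where the one-integer door is shut.
* §2 (X8 ∩ ¬surj) `X8.conjA_of_not_surj_of_homTrivial` — **(A) ⟸ Deo–Ray–Sujatha 2023 Thm. 3.8/3.9 with
  (c2) AS PRINTED** (`Hom_G(H′_L, E[3]) = 0`: `E[3]` does not occur in the `S`-split quotient of `Cl(L)/3`;
  tree fact `DeoRaySujatha2023.thm39_fineSelmerDual_moduleFinite_of_homTrivial_divisionField`) and (c3)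
  (`E(ℚ_v)[3] = 0` at `v = 3` and the bad places), with `p ≠ 2`, `E[3]` irreducible and (c1)
  `3 ∤ #Gal(ℚ(E[3])/ℚ) = 16` DISCHARGED on the class (`ClassX8.p_ne_two`, `ClassX8.irr'`, ty2 g3's
  `ClassX8.not_dvd_card_aut_divisionField_of_not_surj`).  Census: (c3) holds on 2 of the 19 cells
  (442225bz1, 288800cu1 — kit j283348 column `c3`), where (c2) is an isotypic class-group computation
  (this seat's kit job, HOME/p2).
* §3 the Fukuda doors at the leaf (`X8.conjA_of_not_surj_of_classGroupPRank_one_eq`, `…_classNumberPExp_one_eq`)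
  under the STRUCTURAL binder `hram` «the cyclotomic `ℤ₃`-extension of `ℚ(W[3])` is totally ramified
  above `3` from layer 0» (true on the class: one prime above `3` with `e = 8` prime to `3`, `L/ℚ` Galois of
  degree 16 — NOT yet a tree theorem for `K ≠ ℚ`; TURNKEY to ty2; displayed, never discharged silently).
* §4 **R-60 (cell referee, 18:09:55Z) — the NON-VACUOUS class form**
  `muBoundSmallImageX8_of_perPairCertificates`: 20622 BY NAME ⟸ for every small-image X8 pair of analytic
  rank `≤ 1` and every newform / Sprung pair, ONE of the doors — (d1) `3 ∤ h(ℚ(W[3]))`, (d2) Fukuda's rank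
  certificate, (d3) Fukuda's order certificate, (d4) Deo–Ray–Sujatha's (c2) ∧ (c3), (d5) (A) at `(W, 3)`
  by any other means (a `3`-congruent partner `PrintX8MuBoundConjA.conjA_of_congruent`, …), (d6) ONE colour
  of unit content (p1 g2's analytic rider, road (β)).  On the 61 census cells door (d6) is certified 61/61 (ty3 g2's
  two-engine Mazur–Tate records), (d1) on 42/61 — so, unlike the one-integer class forms
  (`muBoundSmallImageX8_of_classNumbers`, `…_of_classNumberCertificates`: their hypothesis «`3 ∤ h` for
  EVERY small-image X8 curve of rank `≤ 1`» is DATA-FALSE on 19 census cells, hence those implications are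
  vacuous — usable PER PAIR only, ref R-60), this hypothesis is not refuted by any census cell.  It remains a
  statement about an INFINITE class and is NOT asserted; closes nothing.

All theorems CONDITIONAL on the displayed binders (`hCK`, `h3`, `hCS`, `hF1`/`hF2`, `hDRS`, `hram`); (A)
is not asserted anywhere.  References: [Fukuda1994] Thm. 1 (1)/(2) p. 264; [CoatesSujatha2005] §3 (A),
Thm. 3.4; [DeoRaySujatha2023] Thm. 3.8/3.9, Lemma 5.1; [Greenberg2001IwasawaPastPresent] Prop. 2.1;
[Sprung2012] Def. 6.1, Thm. 7.14 (3), Prop. 7.19; [Serre1972] §1.11 Prop. 12; tree (imports = the route file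
`Theses/PrintX8.lean` + ROUTE-INDEPENDENT modules only): `PrintX8SmallImageMuBoundConjA.lean` (p2 g2 p547286),
`PrintX8SharpFlatMuDefect.lean` (p1 g2 p546801), `Supersingular/X8PrintDischargeOnePrime.lean` (ty2 g3 p551187),
`IwasawaTheory/ClassicalMuInvariant.lean` §5, `EllipticCurves/FineSelmerClassGroupCriterion.lean`; sibling class forms:
`PrintX8SmallImageMuBoundConjAGlue.lean` (p2 g2 p548155/p553334), `PrintX8SharpFlatMuBoundGlue.lean` (p1 g2 p548147).
-/

set_option linter.dupNamespace false
set_option autoImplicit false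

noncomputable section

open scoped Classical NumberField MatrixGroups ModularForm nonZeroDivisors

open NumberField IsDedekindDomain WeierstrassCurve CongruenceSubgroup Field
  Literature.NumberTheory.EllipticCurves Literature.NumberTheory.EllipticCurves.ModularForms
  Literature.NumberTheory.EllipticCurves.Rank1Residual
  Literature.NumberTheory.EllipticCurves.Rank1Residual.Typed
  Literature.NumberTheory.EllipticCurves.Sprung2017 Literature.NumberTheory.EllipticCurves.Sprung2012
  Literature.NumberTheory.EllipticCurves.GreenbergVatsal2000
  Literature.NumberTheory.EllipticCurves.ZpExtension Literature.NumberTheory.EllipticCurves.IwasawaAlgebra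
  Literature.NumberTheory.IwasawaTheory
  Summit.BirchSwinnertonDyer.BirchSwinnertonDyer.Theorems
  Summit.BirchSwinnertonDyer.BirchSwinnertonDyer.Theorems.PrintX8MuBoundConjA
  Summit.BirchSwinnertonDyer.BirchSwinnertonDyer.Theorems.PrintX8SharpFlatMuTransfer
  Summit.BirchSwinnertonDyer.BirchSwinnertonDyer.Theses.PrintX8
  Summit.BirchSwinnertonDyer.Rank1Residual.Supersingular

namespace Summit.BirchSwinnertonDyer.BirchSwinnertonDyer.Theorems.PrintX8MuBoundCertificates

/-! ### §1 Fukuda's first-layer certificates ⟹ (A), for any elliptic curve over `ℚ` and odd `p` -/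

/-- **(A) at `(E, p)` from Fukuda 1994 Thm. 1 (2) (the `p`-RANK certificate).**  For `E/ℚ`, `p` odd and
`L = ℚ(E[p])` (`W.divisionField p`): if every cyclotomic `ℤ_p`-extension `κL` of `L` has Fukuda's index
`n₀ = 0` (`TotallyRamifiedFrom κL 0`: each ramified prime is totally ramified in `L_∞/L`) and
`rank_p Cl(L₁) = rank_p Cl(L₀)` (`classGroupPRank κL 1 = classGroupPRank κL 0`), then by Fukuda's theorem
(named fact `hF2`, with its printed rider «`μ_p(K/k) = 0`») the classical `μ`-invariant of `L_∞/L` vanishes,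
and Coates–Sujatha 2005 Thm. 3.4 (named fact `hCS`) gives statement (A): the dual fine Selmer group of `E`
over `ℚ_cyc` is finitely generated over `ℤ_p`.  CONDITIONAL on the two named facts; (A) not asserted.
[cite: Fukuda1994, Thm. 1 (2), p. 264] [cite: CoatesSujatha2005, Thm. 3.4 (§3)]
[cite: KuriharaPollack2007, §3.1 (chapter p. 26)] -/
theorem conjA_of_totallyRamifiedFrom_of_classGroupPRank_one_eq
    (hF2 : fukuda1994_thm1_classGroupPRank_const_of_succ_eq)
    (hCS : CoatesSujatha2005.thm34_fineSelmerDual_moduleFinite_of_classicalMuVanishes_divisionField)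
    (W : WeierstrassCurve ℚ) [W.IsElliptic] (p : ℕ) [Fact p.Prime] [NeZero p] (hp : p ≠ 2)
    (hram : ∀ κL : ZpExtension (W.divisionField p) p, κL.IsCyclotomic → TotallyRamifiedFrom κL 0)
    (hrk : ∀ κL : ZpExtension (W.divisionField p) p, κL.IsCyclotomic →
      classGroupPRank κL 1 = classGroupPRank κL 0)
    (κ : ZpExtension ℚ p) (hκ : κ.IsCyclotomic) :
    ∃ (γ : absoluteGaloisGroup ℚ) (D : W.FineSelmerDualData κ γ),
      Module.Finite ℤ_[p] (RestrictScalars ℤ_[p] (IwasawaAlgebra p) D.X) := by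
  haveI : NumberField (W.divisionField p) := NumberField.mk
  refine hCS W p hp ?_ κ hκ
  intro κL hL
  exact classicalMuVanishes_of_classGroupPRank_succ_eq hF2 κL (hram κL hL) le_rfl (hrk κL hL)

/-- **(A) at `(E, p)` from Fukuda 1994 Thm. 1 (1) (the class-number-ORDER certificate).**  As
`conjA_of_totallyRamifiedFrom_of_classGroupPRank_one_eq`, with the hypothesis `ord_p h(L₁) = ord_p h(L₀)`
(`classNumberPExp κL 1 = classNumberPExp κL 0`): Fukuda's Thm. 1 (1) (named fact `hF1`) makes the `p`-class
numbers constant up the tower (`λ = μ = 0`), then Coates–Sujatha Thm. 3.4.  CONDITIONAL; (A) not asserted.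
[cite: Fukuda1994, Thm. 1 (1), p. 264] [cite: CoatesSujatha2005, Thm. 3.4 (§3)] -/
theorem conjA_of_totallyRamifiedFrom_of_classNumberPExp_one_eq
    (hF1 : fukuda1994_thm1_classNumberPExp_const_of_succ_eq)
    (hCS : CoatesSujatha2005.thm34_fineSelmerDual_moduleFinite_of_classicalMuVanishes_divisionField)
    (W : WeierstrassCurve ℚ) [W.IsElliptic] (p : ℕ) [Fact p.Prime] [NeZero p] (hp : p ≠ 2)
    (hram : ∀ κL : ZpExtension (W.divisionField p) p, κL.IsCyclotomic → TotallyRamifiedFrom κL 0)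
    (hord : ∀ κL : ZpExtension (W.divisionField p) p, κL.IsCyclotomic →
      classNumberPExp κL 1 = classNumberPExp κL 0)
    (κ : ZpExtension ℚ p) (hκ : κ.IsCyclotomic) :
    ∃ (γ : absoluteGaloisGroup ℚ) (D : W.FineSelmerDualData κ γ),
      Module.Finite ℤ_[p] (RestrictScalars ℤ_[p] (IwasawaAlgebra p) D.X) := by
  haveI : NumberField (W.divisionField p) := NumberField.mk
  refine hCS W p hp ?_ κ hκ
  intro κL hL
  exact classicalMuVanishes_of_classNumberPExp_succ_eq hF1 κL (hram κL hL) le_rfl (hord κL hL)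

/-! ### §2 Deo–Ray–Sujatha's (c2)-as-printed door on X8 ∩ {¬ surj(3)}: (c1), `p ≠ 2`, irreducibility discharged -/

/-- **(A) at an X8 pair with `ρ̄_{W,3}` not onto, from Deo–Ray–Sujatha 2023 Thm. 3.8/3.9 with (c2) AS
PRINTED and (c3).**  Of the fact's hypotheses (`DeoRaySujatha2023.thm39_fineSelmerDual_moduleFinite_of_homTrivial_divisionField`):
`p ≠ 2` (`ClassX8.p_ne_two`), `E[p]` irreducible (`ClassX8.irr'`, Serre 1972 Prop. 12) and (c1)
`p ∤ #Gal(ℚ(E[p])/ℚ)` (`= 16` on the class; ty2 g3's `ClassX8.not_dvd_card_aut_divisionField_of_not_surj`,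
the fact's Lemma 5.1 form) are DISCHARGED by name; the per-pair certificates that remain displayed are
(c2) «every `Gal(L/ℚ)`-equivariant additive map `Cl(𝓞_L) → E[3]` killing the classes of the primes of `L`
above `3` and above the bad primes is zero» (`E[3]` does not occur in the `S`-split quotient of `Cl(L)/3`
— an isotypic class-group computation) and (c3) «no non-zero `D_v`-fixed `3`-torsion at `v = 3` and the bad
places» (`E(ℚ_v)[3] = 0`).  CONDITIONAL on the named fact `hDRS`; (A) not asserted.
[cite: DeoRaySujatha2023, §3 Thm. 3.8 (c2), Thm. 3.9 (b) (arXiv:2202.09937 pp. 9–10) and §5 Lemma 5.1 (p. 17)]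
[cite: Serre1972, §1.11 Prop. 12] -/
theorem X8.conjA_of_not_surj_of_homTrivial
    (hDRS : DeoRaySujatha2023.thm39_fineSelmerDual_moduleFinite_of_homTrivial_divisionField)
    (W : WeierstrassCurve ℚ) [W.IsElliptic] [W.IsGloballyMinimal] (p : ℕ) [Fact p.Prime]
    (hX : ClassX8 W p) (hns : ¬ Surj W p)
    (hc2 : haveI : NeZero p := ⟨(Fact.out : p.Prime).ne_zero⟩
     haveI : NumberField (W.divisionField p) := NumberField.mk
     ∀ f : Additive (ClassGroup (𝓞 (W.divisionField p))) →+ geomTorsion W (p : ℤ),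
      (∀ (τ : Field.absoluteGaloisGroup ℚ) (I J : (Ideal (𝓞 (W.divisionField p)))⁰),
          (J : Ideal (𝓞 (W.divisionField p))) =
            (I : Ideal (𝓞 (W.divisionField p))).map
              (galRestrict ℤ ℚ (W.divisionField p) (𝓞 (W.divisionField p))
                (Literature.NumberTheory.GaloisRepresentations.absRestrictNormalHom (W.divisionField p) τ)) →
          f (Additive.ofMul (ClassGroup.mk0 J)) = τ • f (Additive.ofMul (ClassGroup.mk0 I))) →
      (∀ (𝔓 : HeightOneSpectrum (𝓞 (W.divisionField p))) (I : (Ideal (𝓞 (W.divisionField p)))⁰)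
          (q : ℕ) (v : HeightOneSpectrum (𝓞 ℚ)), q.Prime →
          (I : Ideal (𝓞 (W.divisionField p))) = 𝔓.asIdeal →
          ((q : ℕ) : 𝓞 (W.divisionField p)) ∈ 𝔓.asIdeal → ((q : ℕ) : 𝓞 ℚ) ∈ v.asIdeal →
          (q = p ∨ ¬ W.HasGoodReductionAt v) →
          f (Additive.ofMul (ClassGroup.mk0 I)) = 0) →
      f = 0)
    (hc3 : ∀ v : HeightOneSpectrum (𝓞 ℚ), (((p : ℕ) : 𝓞 ℚ) ∈ v.asIdeal ∨ ¬ W.HasGoodReductionAt v) →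
      ∀ x : W.geomPrimaryTorsion p, p • x = 0 →
        (∀ d ∈ Literature.NumberTheory.EllipticCurves.GreenbergSelmer.decomp v, d • x = x) → x = 0)
    (κ : ZpExtension ℚ p) (hκ : κ.IsCyclotomic) :
    ∃ (γ : absoluteGaloisGroup ℚ) (D : W.FineSelmerDualData κ γ),
      Module.Finite ℤ_[p] (RestrictScalars ℤ_[p] (IwasawaAlgebra p) D.X) :=
  hDRS W p (ClassX8.p_ne_two W p hX) (ClassX8.irr' W p hX)
    (ClassX8.not_dvd_card_aut_divisionField_of_not_surj W p hX hns) hc2 hc3 κ hκ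

/-! ### §3 The Fukuda doors at the leaf X8 ∩ {¬ surj(3)} (structural binder `hram` displayed) -/

/-- **(A) at an X8 pair from Fukuda's `3`-RANK certificate**: for an X8 curve `W` (so `p = 3`), granted
Fukuda 1994 Thm. 1 (2) (`hF2`), Coates–Sujatha Thm. 3.4 (`hCS`) and the structural binder `hram` (every
cyclotomic `ℤ₃`-extension of `ℚ(W[3])` is totally ramified above `3` from layer 0 — on X8 ∩ ¬surj the field
has ONE prime above `3` with `e = 8`, ty2 g3; `n₀ = 0` is not yet a tree theorem for `K ≠ ℚ` and is displayed,
cf. `IwasawaTheory.totallyRamifiedFrom_zero_of_isCyclotomic_rat` for `K = ℚ`), the TWO-INTEGER certificate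
`rank_3 Cl(ℚ(W[3])₁) = rank_3 Cl(ℚ(W[3]))` gives (A) at `(W, 3)`.  CONDITIONAL; (A) not asserted.
[cite: Fukuda1994, Thm. 1 (2), p. 264] [cite: CoatesSujatha2005, Thm. 3.4 (§3)] -/
theorem X8.conjA_of_classGroupPRank_one_eq
    (hF2 : fukuda1994_thm1_classGroupPRank_const_of_succ_eq)
    (hCS : CoatesSujatha2005.thm34_fineSelmerDual_moduleFinite_of_classicalMuVanishes_divisionField)
    (W : WeierstrassCurve ℚ) [W.IsElliptic] [W.IsGloballyMinimal] (p : ℕ) [Fact p.Prime]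
    (hX : ClassX8 W p)
    (hram : haveI : NeZero p := ⟨(Fact.out : p.Prime).ne_zero⟩
      ∀ κL : ZpExtension (W.divisionField p) p, κL.IsCyclotomic → TotallyRamifiedFrom κL 0)
    (hrk : haveI : NeZero p := ⟨(Fact.out : p.Prime).ne_zero⟩
      ∀ κL : ZpExtension (W.divisionField p) p, κL.IsCyclotomic →
        classGroupPRank κL 1 = classGroupPRank κL 0)
    (κ : ZpExtension ℚ p) (hκ : κ.IsCyclotomic) :
    ∃ (γ : absoluteGaloisGroup ℚ) (D : W.FineSelmerDualData κ γ),
      Module.Finite ℤ_[p] (RestrictScalars ℤ_[p] (IwasawaAlgebra p) D.X) :=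
  haveI : NeZero p := ⟨(Fact.out : p.Prime).ne_zero⟩
  conjA_of_totallyRamifiedFrom_of_classGroupPRank_one_eq hF2 hCS W p (ClassX8.p_ne_two W p hX) hram hrk κ hκ

/-- **(A) at an X8 pair from Fukuda's class-number-ORDER certificate** `ord_3 h(ℚ(W[3])₁) = ord_3 h(ℚ(W[3]))`,
granted Fukuda 1994 Thm. 1 (1) (`hF1`), Coates–Sujatha Thm. 3.4 (`hCS`) and the structural binder `hram` (as in
`X8.conjA_of_classGroupPRank_one_eq`).  CONDITIONAL; (A) not asserted.
[cite: Fukuda1994, Thm. 1 (1), p. 264] [cite: CoatesSujatha2005, Thm. 3.4 (§3)] -/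
theorem X8.conjA_of_classNumberPExp_one_eq
    (hF1 : fukuda1994_thm1_classNumberPExp_const_of_succ_eq)
    (hCS : CoatesSujatha2005.thm34_fineSelmerDual_moduleFinite_of_classicalMuVanishes_divisionField)
    (W : WeierstrassCurve ℚ) [W.IsElliptic] [W.IsGloballyMinimal] (p : ℕ) [Fact p.Prime]
    (hX : ClassX8 W p)
    (hram : haveI : NeZero p := ⟨(Fact.out : p.Prime).ne_zero⟩
      ∀ κL : ZpExtension (W.divisionField p) p, κL.IsCyclotomic → TotallyRamifiedFrom κL 0)
    (hord : haveI : NeZero p := ⟨(Fact.out : p.Prime).ne_zero⟩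
      ∀ κL : ZpExtension (W.divisionField p) p, κL.IsCyclotomic →
        classNumberPExp κL 1 = classNumberPExp κL 0)
    (κ : ZpExtension ℚ p) (hκ : κ.IsCyclotomic) :
    ∃ (γ : absoluteGaloisGroup ℚ) (D : W.FineSelmerDualData κ γ),
      Module.Finite ℤ_[p] (RestrictScalars ℤ_[p] (IwasawaAlgebra p) D.X) :=
  haveI : NeZero p := ⟨(Fact.out : p.Prime).ne_zero⟩
  conjA_of_totallyRamifiedFrom_of_classNumberPExp_one_eq hF1 hCS W p (ClassX8.p_ne_two W p hX) hram hord κ hκ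

/-! ### §4 R-60: the non-vacuous DISJUNCTIVE class form of 20622 (one certificate door per pair) -/

/-- **20622 `MuBoundSmallImageX8` BY NAME ⟸ ONE CERTIFICATE DOOR PER PAIR** (cell referee R-60, 18:09:55Z:
«a non-vacuous class form of road (γ) takes a per-pair DISJUNCTION of certificates»).  Granted the construction
fact `hCK` (p543968), the period unit at `3` (`h3`), Coates–Sujatha Thm. 3.4 (`hCS`), Fukuda 1994 Thm. 1 (1)/(2)
(`hF1`, `hF2`), Deo–Ray–Sujatha Thm. 3.8/3.9 (`hDRS`) and the structural binder `hram` (total ramification above `3` from layer 0 of the cyclotomic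
`ℤ₃`-tower of `ℚ(W[3])` on X8 ∩ ¬surj): if for every X8 curve `W` with `ρ̄_{W,3}` NOT onto and analytic rank
`≤ 1`, every newform `f` of `W` and every Sprung pair `(L♯, L♭)` of `f` at `3`, ONE of
(d1) `3 ∤ h(ℚ(W[3]))` (Iwasawa 1956 door, p2 g2; census 42/61),
(d2) `rank_3 Cl(ℚ(W[3])₁) = rank_3 Cl(ℚ(W[3]))` (Fukuda's rank door),
(d3) `ord_3 h(ℚ(W[3])₁) = ord_3 h(ℚ(W[3]))` (Fukuda's order door),
(d4) Deo–Ray–Sujatha's certificates (c2)-as-printed ∧ (c3) (§2; census: (c3) on 2 of the 19 `3 ∣ h` cells),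
(d5) statement (A) at `(W, 3)` by any other means (e.g. a `3`-congruent partner, `PrintX8MuBoundConjA.conjA_of_congruent`),
(d6) SOME colour `L^{•₀}` has a unit coefficient (the one-colour analytic rider, p1 g2's road (β); census 61/61
by ty3 g2's two-engine Mazur–Tate records)
holds, then `μ(X^•) ≤ μ(Λ/(L^•))` for every colour with `L^• ≠ 0` on every such pair, i.e. the item.  Doors
(d1)–(d5) go through (A) and `PrintX8MuBoundConjA.X8.muBound_of_conjA`; door (d6) through p1 g2's
`PrintX8SharpFlatMuTransfer.X8.sharpFlatMu_le_of_oneColour_hasUnitContent`.  NON-VACUOUS on the census (no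
cell refutes the disjunction; contrast the one-integer class forms `PrintX8MuBoundConjAGlue.muBoundSmallImageX8_of_classNumbers`
/ `…_of_classNumberCertificates`, whose hypothesis «`3 ∤ h` for EVERY small-image X8 curve» is DATA-FALSE on 19
census cells — class-wide FALSE, strictly stronger than `μ = 0`, usable PER PAIR only), but a statement about an
INFINITE class, NOT asserted.  CONDITIONAL; closes nothing.
[cite: Fukuda1994, Thm. 1 (1)/(2), p. 264] [cite: CoatesSujatha2005, §3 statement (A), Thm. 3.4]
[cite: Greenberg2001IwasawaPastPresent, Prop. 2.1 p. 339] [cite: Sprung2012, Def. 6.1 (p. 1495), Thm. 7.14 (3) (p. 1504), Prop. 7.19 (p. 1505)]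
[cite: DeoRaySujatha2023, §3 Thm. 3.8 (c2), Thm. 3.9 (b) (arXiv:2202.09937 pp. 9–10)]
[cite: Kato2004Asterisque, Thm. 12.6 (p. 222), §17.13 (p. 280)] -/
theorem muBoundSmallImageX8_of_perPairCertificates (hCK : thm714seq_sharpFlatColemanKato_zeta)
    (h3 : realPeriodRat_eq_unit_mul_plusPeriod_three)
    (hCS : CoatesSujatha2005.thm34_fineSelmerDual_moduleFinite_of_classicalMuVanishes_divisionField)
    (hF1 : fukuda1994_thm1_classNumberPExp_const_of_succ_eq)
    (hF2 : fukuda1994_thm1_classGroupPRank_const_of_succ_eq)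
    (hDRS : DeoRaySujatha2023.thm39_fineSelmerDual_moduleFinite_of_homTrivial_divisionField)
    (hram : ∀ (W : WeierstrassCurve ℚ) [W.IsElliptic] [W.IsGloballyMinimal],
      ClassX8 W 3 → ¬ Surj W 3 →
        ∀ κL : ZpExtension (W.divisionField 3) 3, κL.IsCyclotomic → TotallyRamifiedFrom κL 0)
    (hdoor : ∀ (W : WeierstrassCurve ℚ) [W.IsElliptic] [W.IsGloballyMinimal],
      ClassX8 W 3 → ¬ Surj W 3 → W.analyticRank ≤ 1 →
      ∀ (N : ℕ) (_ : NeZero N) (f : CuspForm (Gamma0 N) 2) (Lsharp Lflat : IwasawaAlgebra 3),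
        IsNewformOf W f → IsSprungPair f 3 (W.frobeniusTrace 3) Lsharp Lflat →
        (haveI : NumberField (W.divisionField 3) := NumberField.mk
         ¬ 3 ∣ NumberField.classNumber (W.divisionField 3)) ∨
        (∀ κL : ZpExtension (W.divisionField 3) 3, κL.IsCyclotomic →
          classGroupPRank κL 1 = classGroupPRank κL 0) ∨
        (∀ κL : ZpExtension (W.divisionField 3) 3, κL.IsCyclotomic →
          classNumberPExp κL 1 = classNumberPExp κL 0) ∨
        ((haveI : NumberField (W.divisionField 3) := NumberField.mk
          ∀ φ : Additive (ClassGroup (𝓞 (W.divisionField 3))) →+ geomTorsion W (3 : ℤ),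
            (∀ (τ : Field.absoluteGaloisGroup ℚ) (I J : (Ideal (𝓞 (W.divisionField 3)))⁰),
                (J : Ideal (𝓞 (W.divisionField 3))) =
                  (I : Ideal (𝓞 (W.divisionField 3))).map
                    (galRestrict ℤ ℚ (W.divisionField 3) (𝓞 (W.divisionField 3))
                      (Literature.NumberTheory.GaloisRepresentations.absRestrictNormalHom
                        (W.divisionField 3) τ)) →
                φ (Additive.ofMul (ClassGroup.mk0 J)) = τ • φ (Additive.ofMul (ClassGroup.mk0 I))) →
            (∀ (𝔓 : HeightOneSpectrum (𝓞 (W.divisionField 3))) (I : (Ideal (𝓞 (W.divisionField 3)))⁰)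
                (q : ℕ) (v : HeightOneSpectrum (𝓞 ℚ)), q.Prime →
                (I : Ideal (𝓞 (W.divisionField 3))) = 𝔓.asIdeal →
                ((q : ℕ) : 𝓞 (W.divisionField 3)) ∈ 𝔓.asIdeal → ((q : ℕ) : 𝓞 ℚ) ∈ v.asIdeal →
                (q = 3 ∨ ¬ W.HasGoodReductionAt v) →
                φ (Additive.ofMul (ClassGroup.mk0 I)) = 0) →
            φ = 0) ∧
         (∀ v : HeightOneSpectrum (𝓞 ℚ), (((3 : ℕ) : 𝓞 ℚ) ∈ v.asIdeal ∨ ¬ W.HasGoodReductionAt v) →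
            ∀ x : W.geomPrimaryTorsion 3, 3 • x = 0 →
              (∀ d ∈ Literature.NumberTheory.EllipticCurves.GreenbergSelmer.decomp v, d • x = x) → x = 0)) ∨
        (∀ κ : ZpExtension ℚ 3, κ.IsCyclotomic →
          ∃ (γ : absoluteGaloisGroup ℚ) (D : W.FineSelmerDualData κ γ),
            Module.Finite ℤ_[3] (RestrictScalars ℤ_[3] (IwasawaAlgebra 3) D.X)) ∨
        (∃ col₀ : Chroma, HasUnitContent (chromaticL col₀ Lsharp Lflat))) :
    MuBoundSmallImageX8 := by
  intro W _ _ p _ hX hns hr col κ γ hκ hγ hγ' v hv g hg cneg c hH N hN f Lsharp Lflat hf hSP hcol D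
  haveI := hN
  have hp3 : p = 3 := hX.1
  subst hp3
  rcases hdoor W hX hns hr N hN f Lsharp Lflat hf hSP with hh | hrk | hord | ⟨hc2, hc3⟩ | hA | ⟨col₀, hu₀⟩
  · exact X8.muBound_of_conjA W 3 hCK h3 hX
      (conjA_of_not_dvd_classNumber_of_unique_prime hCS W 3 (by decide) hh
        (ClassX8.existsUnique_prime_divisionField_of_not_surj W 3 hX hns))
      col κ γ hκ hγ hγ' v hv g hg cneg c hH N hN f Lsharp Lflat hf hSP hcol D
  · exact X8.muBound_of_conjA W 3 hCK h3 hX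
      (X8.conjA_of_classGroupPRank_one_eq hF2 hCS W 3 hX (hram W hX hns) hrk)
      col κ γ hκ hγ hγ' v hv g hg cneg c hH N hN f Lsharp Lflat hf hSP hcol D
  · exact X8.muBound_of_conjA W 3 hCK h3 hX
      (X8.conjA_of_classNumberPExp_one_eq hF1 hCS W 3 hX (hram W hX hns) hord)
      col κ γ hκ hγ hγ' v hv g hg cneg c hH N hN f Lsharp Lflat hf hSP hcol D
  · exact X8.muBound_of_conjA W 3 hCK h3 hX (X8.conjA_of_not_surj_of_homTrivial hDRS W 3 hX hns hc2 hc3)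
      col κ γ hκ hγ hγ' v hv g hg cneg c hH N hN f Lsharp Lflat hf hSP hcol D
  · exact X8.muBound_of_conjA W 3 hCK h3 hX hA col κ γ hκ hγ hγ' v hv g hg cneg c hH N hN f Lsharp Lflat
      hf hSP hcol D
  · -- road (β): one colour of unit content (p1 g2), with a period ratio for `f` from the period fact at `3`
    obtain ⟨u, hu1, hΩ⟩ := h3 W hX.2.1.1 (ClassX8.irr W 3 hX) f hf
    have hu0 : (u : ℝ) ≠ 0 := by
      intro h
      have h0 : u = 0 := by exact_mod_cast h
      rw [h0] at hu1
      simp at hu1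
    have hϖ : ((u⁻¹ : ℚ) : ℝ) * W.realPeriodRat = plusPeriod f := by
      rw [hΩ, Rat.cast_inv, ← mul_assoc, inv_mul_cancel₀ hu0, one_mul]
    exact X8.sharpFlatMu_le_of_oneColour_hasUnitContent W 3 hCK h3 hX hns f hf u⁻¹ hϖ κ γ hκ hγ hγ' v hv g
      hg cneg c hH hSP col₀ hu₀ col hcol D

end Summit.BirchSwinnertonDyer.BirchSwinnertonDyer.Theorems.PrintX8MuBoundCertificates


/-! ## APPEND (p2 g3, 2026-08-27T19:1xZ): the binder-free class form — `hram` DISCHARGED by the route-independent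
`Theorems/PrintX8SmallImageTotallyRamified.lean` (p559577: Fukuda's index `n₀ = 0` for the cyclotomic `ℤ₃`-tower of
`ℚ(W[3])` on X8 ∩ ¬surj, `PrintX8TotallyRamified.ClassX8.totallyRamifiedFrom_zero_divisionField_of_not_surj`).  Census of
record (kit j286936 / j287154, HOME/p2): per pair the doors certify statement (A) on 60 of the 61 small-image cells (42 by one
class number, 17 by Fukuda's rank door, 1 by Deo–Ray–Sujatha) — DATA (GRH), never PARTITION; the class-wide item stays OPEN. -/

namespace Summit.BirchSwinnertonDyer.BirchSwinnertonDyer.Theorems.PrintX8MuBoundCertificates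

open Summit.BirchSwinnertonDyer.BirchSwinnertonDyer.Theorems.PrintX8TotallyRamified

/-- **20622 `MuBoundSmallImageX8` BY NAME ⟸ ONE CERTIFICATE DOOR PER PAIR, binder-free** — the class form
`PrintX8MuBoundCertificates.muBoundSmallImageX8_of_perPairCertificates` (R-60) with its structural binder `hram`
DISCHARGED by `ClassX8.totallyRamifiedFrom_zero_divisionField_of_not_surj`: granted only the NAMED FACTS `hCK`
(Sprung 2012 ♯/♭ construction), `h3` (period unit at `3`), `hCS` (Coates–Sujatha Thm. 3.4), `hF1`/`hF2` (Fukuda 1994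
Thm. 1) and `hDRS` (Deo–Ray–Sujatha Thm. 3.8/3.9), if every small-image X8 pair of analytic rank `≤ 1` passes ONE of
the six doors (`3 ∤ h(ℚ(W[3]))` / Fukuda rank / Fukuda order / DRS (c2)∧(c3) / (A) otherwise / one colour of unit
content), then the item holds.  NON-VACUOUS on the census; a statement about an INFINITE class, NOT asserted;
CONDITIONAL; closes nothing. [cite: Fukuda1994, Thm. 1 (1)/(2), p. 264] [cite: CoatesSujatha2005, §3 (A), Thm. 3.4]
[cite: DeoRaySujatha2023, §3 Thm. 3.8/3.9 (arXiv:2202.09937 pp. 9–10)] [cite: Sprung2012, Thm. 7.14 (3) (p. 1504), Prop. 7.19 (p. 1505)] -/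
theorem muBoundSmallImageX8_of_perPairCertificates' (hCK : thm714seq_sharpFlatColemanKato_zeta)
    (h3 : realPeriodRat_eq_unit_mul_plusPeriod_three)
    (hCS : CoatesSujatha2005.thm34_fineSelmerDual_moduleFinite_of_classicalMuVanishes_divisionField)
    (hF1 : fukuda1994_thm1_classNumberPExp_const_of_succ_eq)
    (hF2 : fukuda1994_thm1_classGroupPRank_const_of_succ_eq)
    (hDRS : DeoRaySujatha2023.thm39_fineSelmerDual_moduleFinite_of_homTrivial_divisionField)
    (hdoor : ∀ (W : WeierstrassCurve ℚ) [W.IsElliptic] [W.IsGloballyMinimal],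
      ClassX8 W 3 → ¬ Surj W 3 → W.analyticRank ≤ 1 →
      ∀ (N : ℕ) (_ : NeZero N) (f : CuspForm (Gamma0 N) 2) (Lsharp Lflat : IwasawaAlgebra 3),
        IsNewformOf W f → IsSprungPair f 3 (W.frobeniusTrace 3) Lsharp Lflat →
        (haveI : NumberField (W.divisionField 3) := NumberField.mk
         ¬ 3 ∣ NumberField.classNumber (W.divisionField 3)) ∨
        (∀ κL : ZpExtension (W.divisionField 3) 3, κL.IsCyclotomic →
          classGroupPRank κL 1 = classGroupPRank κL 0) ∨
        (∀ κL : ZpExtension (W.divisionField 3) 3, κL.IsCyclotomic →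
          classNumberPExp κL 1 = classNumberPExp κL 0) ∨
        ((haveI : NumberField (W.divisionField 3) := NumberField.mk
          ∀ φ : Additive (ClassGroup (𝓞 (W.divisionField 3))) →+ geomTorsion W (3 : ℤ),
            (∀ (τ : Field.absoluteGaloisGroup ℚ) (I J : (Ideal (𝓞 (W.divisionField 3)))⁰),
                (J : Ideal (𝓞 (W.divisionField 3))) =
                  (I : Ideal (𝓞 (W.divisionField 3))).map
                    (galRestrict ℤ ℚ (W.divisionField 3) (𝓞 (W.divisionField 3))
                      (Literature.NumberTheory.GaloisRepresentations.absRestrictNormalHom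
                        (W.divisionField 3) τ)) →
                φ (Additive.ofMul (ClassGroup.mk0 J)) = τ • φ (Additive.ofMul (ClassGroup.mk0 I))) →
            (∀ (𝔓 : HeightOneSpectrum (𝓞 (W.divisionField 3))) (I : (Ideal (𝓞 (W.divisionField 3)))⁰)
                (q : ℕ) (v : HeightOneSpectrum (𝓞 ℚ)), q.Prime →
                (I : Ideal (𝓞 (W.divisionField 3))) = 𝔓.asIdeal →
                ((q : ℕ) : 𝓞 (W.divisionField 3)) ∈ 𝔓.asIdeal → ((q : ℕ) : 𝓞 ℚ) ∈ v.asIdeal →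
                (q = 3 ∨ ¬ W.HasGoodReductionAt v) →
                φ (Additive.ofMul (ClassGroup.mk0 I)) = 0) →
            φ = 0) ∧
         (∀ v : HeightOneSpectrum (𝓞 ℚ), (((3 : ℕ) : 𝓞 ℚ) ∈ v.asIdeal ∨ ¬ W.HasGoodReductionAt v) →
            ∀ x : W.geomPrimaryTorsion 3, 3 • x = 0 →
              (∀ d ∈ Literature.NumberTheory.EllipticCurves.GreenbergSelmer.decomp v, d • x = x) → x = 0)) ∨
        (∀ κ : ZpExtension ℚ 3, κ.IsCyclotomic →
          ∃ (γ : absoluteGaloisGroup ℚ) (D : W.FineSelmerDualData κ γ),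
            Module.Finite ℤ_[3] (RestrictScalars ℤ_[3] (IwasawaAlgebra 3) D.X)) ∨
        (∃ col₀ : Chroma, HasUnitContent (chromaticL col₀ Lsharp Lflat))) :
    MuBoundSmallImageX8 :=
  muBoundSmallImageX8_of_perPairCertificates hCK h3 hCS hF1 hF2 hDRS
    (fun W _ _ hX hns κL hκL => ClassX8.totallyRamifiedFrom_zero_divisionField_of_not_surj W 3 hX hns κL hκL)
    hdoor

end Summit.BirchSwinnertonDyer.BirchSwinnertonDyer.Theorems.PrintX8MuBoundCertificates

end
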